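import Mathlib
import HarnessLib
import Summits.HubbardSuperconductivity.HubbardSuperconductivity.Theorems.KLProgrammeC4aFirstOrderLevelLine
import Summits.HubbardSuperconductivity.HubbardSuperconductivity.Theorems.KLProgrammeC4aBubbleTubeDerivAll

/-!
# Route `KLProgramme` — crux C4a, S3 brick (B4) «(U1)-HYBRID» B-1 (x): THE FIRST-ORDER CO-MOVING JET OF THE TUBE PIECE IN THE CURRENCY OF `firstOrderLayer_abs_le` —
# for a real level profile `f` supported in `(−hi, hi)` and a real smooth kernel `K`:
# `‖∂_θ ∫ f(e)·(∫ J(e,φ+θ)·K(ē) dφ) de‖ = |∫_{−hi}^{hi} f(e) ∫_{−π}^{π} J(e,v+θ)·G·K′(ē) dv de|`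

Cell `gate-hubbard-kl`, seat hubbard-kl-k3c3-p3 (g37; row «implicit-function / monotonicity route for μ(n)»).  Located brick for the (C)-closer lane / the `M₁`
assembly (stub (C) `stub_twoLeg_curvature` of `KLRegimeEngineV17F2`, stmt-HubbardSuperconductivity-20437), memo HOME/hubbard-kl-k3c3-p3/U1-CAUSTIC-SUP.md §19–§20 (B-1).

WHY.  (B3) differentiates the tube piece of the co-moving bubble under both integrals (`…C4aBubbleTubeDerivAll.iteratedDeriv_levelIntegral_pp_eq`); B-1 (vii)
(`…C4aFirstOrderLevelLine.hasDerivAt_loopIntegral_pp_abs`) puts the first-order jet of each level line into the absolute currency `∫(J·G)·Ψ′(ē)`; for a REAL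
kernel `Ψ = (K : ℝ → ℂ)` and a REAL profile `f` the result is the real number whose `ϑ`-integral `…C4aFirstOrderLayerSum.firstOrderLayer_abs_le` bounds
(weight `wt := f`, Jacobian family `Jw e v := J(e, v+θ)` — rows `…C4aFirstOrderJacobianRows`).
* `loopIntegral_firstOrder_ofReal` — `∂_θ I(e;θ) = ((∫_{−π}^{π} J·G·K′(ē) dv : ℝ) : ℂ)` for a real smooth kernel;
* **`iteratedDeriv_one_tubePiece_eq`** — `∂_θ ∫_{(−r,r)} f(e)·I(e;θ) de = ((∫_{−hi}^{hi} f(e)·(∫_{−π}^{π} J·G·K′(ē) dv) de : ℝ) : ℂ)`;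
* **`norm_iteratedDeriv_one_tubePiece_eq`** — its norm is `|∫_{−hi}^{hi} f ∫ J·G·K′(ē)|`.
Sizes binder shape; pure bookkeeping on landed objects; nothing asserts (C), K3 or superconductivity.
References: FST II CPAM 51 (1998) §3 [cite: FeldmanSalmhoferTrubowitz1998]; BGM 2006 §2.4 (2.40) [cite: BenfattoGiulianiMastropietro2006].
-/

noncomputable section

namespace Summit.HubbardSuperconductivity.HubbardSuperconductivity.Theorems.C4a

set_option linter.dupNamespace false -- summit = problem name (single-conjunct summit), D-0017

open Real Set Filter MeasureTheory intervalIntegral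
open scoped Topology ContDiff
open Literature.MathematicalPhysics.QuantumLattice Literature.MathematicalPhysics.QuantumLattice.BandSectorCounting Literature.Probability.LatticeModels
open Summit.HubbardSuperconductivity.HubbardSuperconductivity.Theorems.KLRegimeSplit
open Summit.HubbardSuperconductivity.HubbardSuperconductivity.Theorems.DispersionFlow
open Summit.HubbardSuperconductivity.HubbardSuperconductivity.Theorems.PerturbedFermiCurve

section Sizes

variable {K : TrigPolyC4v} {A : ℝ} (hA : ∀ p : Momentum, ∀ j ≤ 2, ‖iteratedFDeriv ℝ j (frameShift K) p‖ ≤ A) (hA20 : A ≤ 1 / 20)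
  (hd : klCurveD ≤ (bandBounds (show (-4 : ℝ) < -1.1 by norm_num) (show (-1.1 : ℝ) ≤ -0.1 by norm_num)
    (show (-0.1 : ℝ) < 0 by norm_num)).Dtmin - 2 * A)
  {μ r : ℝ} (hr : 0 < r) (hlo : (-1.1 : ℝ) < μ - r - A) (hhi : μ + r + A < -0.1)
  {A₃ A₄ : ℝ} (hA₃ : ∀ p : Momentum, ‖iteratedFDeriv ℝ 3 (frameShift K) p‖ ≤ A₃)
  (hA₄ : ∀ p : Momentum, ‖iteratedFDeriv ℝ 4 (frameShift K) p‖ ≤ A₄)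
  {K₁ : ℝ} (hK₁ : ∀ p : Momentum, ‖fderiv ℝ (frameLevel μ K) p‖ ≤ K₁)
include hA hA20 hd hr hlo hhi hA₃ hA₄ hK₁

/-- **The first-order jet of one level line for a real smooth kernel, as a real number cast**: `|K| ≤ M₀`, `|K′| ≤ M₁`, `|e|, |ρ| < r` ⟹
`∂_θ ∫_{(−π,π)} J(e,φ+θ)·K(ē) dφ = ((∫_{−π}^{π} J(e,v+θ₀)·G·K′(ē) dv : ℝ) : ℂ)`. -/
theorem loopIntegral_firstOrder_ofReal {Kr : ℝ → ℝ} (hK : ContDiff ℝ 2 Kr) {M₀ M₁ : ℝ} (hK0 : ∀ x, |Kr x| ≤ M₀) (hK1 : ∀ x, |deriv Kr x| ≤ M₁)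
    {ρ e : ℝ} (hρ : |ρ| < r) (he : |e| < r) (ϑ θ₀ : ℝ) :
    deriv (fun θ : ℝ => ∫ φ in Ioo (-π) π,
        (levelChartJac μ K (e, φ + θ) : ℝ) • ((Kr (frameLevel μ K (levelPoint μ K 0 θ + levelPoint μ K ρ (ϑ + θ) - levelPoint μ K e (φ + θ))) : ℝ) : ℂ)) θ₀ =
      (((∫ v in (-π)..π, levelChartJac μ K (e, v + θ₀) *
          (fderiv ℝ (frameLevel μ K) (pairSumPath μ K ρ ϑ θ₀ 0 - levelPoint μ K e (v + θ₀)))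
            (iteratedDeriv 1 (levelPoint μ K 0) θ₀ + iteratedDeriv 1 (levelPoint μ K ρ) (ϑ + θ₀)) *
        deriv Kr (frameLevel μ K (pairSumPath μ K ρ ϑ θ₀ 0 - levelPoint μ K e (v + θ₀))) : ℝ) : ℂ)) := by
  set Ψ : ℝ → ℂ := fun u => ((Kr u : ℝ) : ℂ) with hΨdef
  have hΨ : ContDiff ℝ 2 Ψ := Complex.ofRealCLM.contDiff.comp hK
  have hΨ' : ∀ u, deriv Ψ u = ((deriv Kr u : ℝ) : ℂ) := fun u => (((hK.differentiable (by norm_num)) u).hasDerivAt.ofReal_comp).deriv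
  have hΨ0 : ∀ x, ‖Ψ x‖ ≤ M₀ := fun x => by simp only [hΨdef, Complex.norm_real, Real.norm_eq_abs]; exact hK0 x
  have hΨ1 : ∀ x, ‖deriv Ψ x‖ ≤ M₁ := fun x => by rw [hΨ' x, Complex.norm_real, Real.norm_eq_abs]; exact hK1 x
  have h := hasDerivAt_loopIntegral_pp_abs hA hA20 hd hr hlo hhi hA₃ hA₄ hK₁ hΨ hΨ0 hΨ1 hρ he ϑ θ₀
  rw [h.deriv, ← intervalIntegral.integral_ofReal]
  refine intervalIntegral.integral_congr fun v _ => ?_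
  simp only [hΨ', Complex.real_smul, Complex.ofReal_mul]

/-- **THE FIRST-ORDER CO-MOVING JET OF THE TUBE PIECE** (HEADLINE; see the module docstring): `f` real, `C^∞`, `tsupport f ⊆ (−hi, hi)`, `0 ≤ hi < r`; `K` real,
`C^∞`, `|K| ≤ M₀`, `|K′| ≤ M₁`; `|ρ| < r`.  Then `∂_θ ∫_{(−r,r)} f(e)·(∫_{(−π,π)} J(e,φ+θ)·K(ē) dφ) de` at `θ₀` equals
`((∫_{−hi}^{hi} f(e)·(∫_{−π}^{π} J(e,v+θ₀)·G·K′(ē) dv) de : ℝ) : ℂ)`. [cite: BenfattoGiulianiMastropietro2006, §2.4 (2.40)] -/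
theorem iteratedDeriv_one_tubePiece_eq {f : ℝ → ℝ} (hf : ContDiff ℝ ∞ f) {hi : ℝ} (hhi0 : 0 ≤ hi) (hhir : hi < r) (hfsupp : tsupport f ⊆ Ioo (-hi) hi)
    {Kr : ℝ → ℝ} (hK : ContDiff ℝ ∞ Kr) {M₀ M₁ : ℝ} (hK0 : ∀ x, |Kr x| ≤ M₀) (hK1 : ∀ x, |deriv Kr x| ≤ M₁) {ρ : ℝ} (hρ : |ρ| < r) (ϑ θ₀ : ℝ) :
    iteratedDeriv 1 (fun θ : ℝ => ∫ e in Ioo (-r) r, ((f e : ℝ) : ℂ) * ∫ φ in Ioo (-π) π,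
        (levelChartJac μ K (e, φ + θ) : ℝ) • ((Kr (frameLevel μ K (levelPoint μ K 0 θ + levelPoint μ K ρ (ϑ + θ) - levelPoint μ K e (φ + θ))) : ℝ) : ℂ)) θ₀ =
      (((∫ e in (-hi)..hi, f e * ∫ v in (-π)..π, levelChartJac μ K (e, v + θ₀) *
          (fderiv ℝ (frameLevel μ K) (pairSumPath μ K ρ ϑ θ₀ 0 - levelPoint μ K e (v + θ₀)))
            (iteratedDeriv 1 (levelPoint μ K 0) θ₀ + iteratedDeriv 1 (levelPoint μ K ρ) (ϑ + θ₀)) *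
        deriv Kr (frameLevel μ K (pairSumPath μ K ρ ϑ θ₀ 0 - levelPoint μ K e (v + θ₀))) : ℝ) : ℂ)) := by
  set B₀ := bandBounds (show (-4 : ℝ) < -1.1 by norm_num) (show (-1.1 : ℝ) ≤ -0.1 by norm_num) (show (-0.1 : ℝ) < 0 by norm_num) with hB₀
  have hADt : 2 * A < B₀.Dtmin := by have := klCurveD_pos; linarith only [this, hd]
  set fc : ℝ → ℂ := fun e => ((f e : ℝ) : ℂ) with hfc
  have hfcC : ContDiff ℝ ∞ fc := Complex.ofRealCLM.contDiff.comp hf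
  have hfcsupp : tsupport fc ⊆ Ioo (-r) r := by
    have h1 : tsupport fc ⊆ tsupport f := by
      refine closure_mono fun e he => ?_
      simp only [Function.mem_support, ne_eq, hfc, Complex.ofReal_eq_zero] at he ⊢
      exact he
    exact h1.trans (hfsupp.trans (Ioo_subset_Ioo (by linarith) hhir.le))
  set Ψ : ℝ → ℂ := fun u => ((Kr u : ℝ) : ℂ) with hΨdef
  have hΨ : ContDiff ℝ ∞ Ψ := Complex.ofRealCLM.contDiff.comp hK
  -- (B3): the derivative falls under both integrals
  have hB3 := iteratedDeriv_levelIntegral_pp_eq B₀ hA hADt hlo hhi hfcC hfcsupp hΨ hρ ϑ 1 θ₀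
  rw [show (fun θ : ℝ => ∫ e in Ioo (-r) r, ((f e : ℝ) : ℂ) * ∫ φ in Ioo (-π) π,
        (levelChartJac μ K (e, φ + θ) : ℝ) • ((Kr (frameLevel μ K (levelPoint μ K 0 θ + levelPoint μ K ρ (ϑ + θ) - levelPoint μ K e (φ + θ))) : ℝ) : ℂ)) =
      fun θ : ℝ => ∫ e in Ioo (-r) r, fc e * ∫ φ in Ioo (-π) π,
        (levelChartJac μ K (e, φ + θ) : ℝ) • Ψ (frameLevel μ K (levelPoint μ K 0 θ + levelPoint μ K ρ (ϑ + θ) - levelPoint μ K e (φ + θ))) from rfl, hB3]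
  -- per level line: the loop integral of the jet is the absolute-currency real number
  have hline : ∀ e ∈ Ioo (-r) r, (∫ φ in Ioo (-π) π, iteratedDeriv 1 (fun θ : ℝ =>
        (levelChartJac μ K (e, φ + θ) : ℝ) • Ψ (frameLevel μ K (levelPoint μ K 0 θ + levelPoint μ K ρ (ϑ + θ) - levelPoint μ K e (φ + θ)))) θ₀) =
      (((∫ v in (-π)..π, levelChartJac μ K (e, v + θ₀) *
          (fderiv ℝ (frameLevel μ K) (pairSumPath μ K ρ ϑ θ₀ 0 - levelPoint μ K e (v + θ₀)))
            (iteratedDeriv 1 (levelPoint μ K 0) θ₀ + iteratedDeriv 1 (levelPoint μ K ρ) (ϑ + θ₀)) *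
        deriv Kr (frameLevel μ K (pairSumPath μ K ρ ϑ θ₀ 0 - levelPoint μ K e (v + θ₀))) : ℝ) : ℂ)) := by
    intro e he
    have he' : |e| < r := abs_lt.2 he
    rw [← iteratedDeriv_loopIntegral_pp_eq B₀ hA hADt hlo hhi hΨ hρ he' ϑ 1 θ₀, iteratedDeriv_one]
    exact loopIntegral_firstOrder_ofReal hA hA20 hd hr hlo hhi hA₃ hA₄ hK₁ (hK.of_le (by norm_cast)) hK0 hK1 hρ he' ϑ θ₀
  rw [setIntegral_congr_fun measurableSet_Ioo fun e he => by simp only [hfc]; rw [hline e he]]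
  -- a real integrand: pass `ofReal` through, and shrink the level range to the support
  simp_rw [← Complex.ofReal_mul]
  rw [integral_complex_ofReal]
  congr 1
  rw [intervalIntegral.integral_of_le (by linarith), integral_Ioc_eq_integral_Ioo]
  refine setIntegral_eq_of_subset_of_forall_sdiff_eq_zero measurableSet_Ioo (Ioo_subset_Ioo (by linarith) hhir.le) fun e he => ?_
  have hfe : f e = 0 := by
    have : e ∉ tsupport f := fun h => he.2 (hfsupp h)
    exact image_eq_zero_of_notMem_tsupport this
  rw [hfe, zero_mul]

/-- **… and its norm** = the level-box integral that `firstOrderLayer_abs_le` bounds (weight `f`, Jacobian family `J(e, v+θ₀)`). -/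
theorem norm_iteratedDeriv_one_tubePiece_eq {f : ℝ → ℝ} (hf : ContDiff ℝ ∞ f) {hi : ℝ} (hhi0 : 0 ≤ hi) (hhir : hi < r) (hfsupp : tsupport f ⊆ Ioo (-hi) hi)
    {Kr : ℝ → ℝ} (hK : ContDiff ℝ ∞ Kr) {M₀ M₁ : ℝ} (hK0 : ∀ x, |Kr x| ≤ M₀) (hK1 : ∀ x, |deriv Kr x| ≤ M₁) {ρ : ℝ} (hρ : |ρ| < r) (ϑ θ₀ : ℝ) :
    ‖iteratedDeriv 1 (fun θ : ℝ => ∫ e in Ioo (-r) r, ((f e : ℝ) : ℂ) * ∫ φ in Ioo (-π) π,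
        (levelChartJac μ K (e, φ + θ) : ℝ) • ((Kr (frameLevel μ K (levelPoint μ K 0 θ + levelPoint μ K ρ (ϑ + θ) - levelPoint μ K e (φ + θ))) : ℝ) : ℂ)) θ₀‖ =
      |∫ e in (-hi)..hi, f e * ∫ v in (-π)..π, levelChartJac μ K (e, v + θ₀) *
          (fderiv ℝ (frameLevel μ K) (pairSumPath μ K ρ ϑ θ₀ 0 - levelPoint μ K e (v + θ₀)))
            (iteratedDeriv 1 (levelPoint μ K 0) θ₀ + iteratedDeriv 1 (levelPoint μ K ρ) (ϑ + θ₀)) *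
        deriv Kr (frameLevel μ K (pairSumPath μ K ρ ϑ θ₀ 0 - levelPoint μ K e (v + θ₀)))| := by
  rw [iteratedDeriv_one_tubePiece_eq hA hA20 hd hr hlo hhi hA₃ hA₄ hK₁ hf hhi0 hhir hfsupp hK hK0 hK1 hρ ϑ θ₀, Complex.norm_real, Real.norm_eq_abs]

end Sizes

end Summit.HubbardSuperconductivity.HubbardSuperconductivity.Theorems.C4a

end
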